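import Literature.Barriers.CriticalPhenomena.LaceExpansionXSpacePsiBounds
import HarnessLib

/-!
# Hara's corrected triangle `T̄^{(0,0)}_{p_c}`, the bound `Δ_{p_c} ≤ 1 + T̄^{(0,0)}_{p_c}`, and the
# `β = γ = 0` case of `Hara2008_weightedNLoopBoundPc` from the smallness of the triangles
# (Fitzner–van der Hofstad's `d = 11` numerics as hypotheses)

Barrier catalogue `Literature/Barriers/CriticalPhenomena/` (D-0021), companion of
`LaceExpansionXSpaceLemma16.lean` and `LaceExpansionXSpacePsiBounds.lean`. The first reduces
Hara's Lemma 1.6 (percolation, at `p = p_c`) to two named facts, the second of which is the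
analytic estimate

* `Hara2008_weightedNLoopBoundPc` — for `d ≥ 11`, `β, γ ≥ 0` with `W̄^{(β,γ)}, W̄^{(β,0)},
  T̄^{(0,γ)}, H̄^{(β)} < ∞`: `Σ_x |x|^{β+γ} piNDiagramPc d N x ≤ c (N+1)^{2+β+γ} ρ^N`, `ρ < 1`,
  `N ≥ 1` (Hara 2008, §3.4, Steps 1–3 and Summary).

Its printed proof has two layers. (i) Diagrammatic: WITHOUT the weight `|x|^{β+γ}` the bound is
Heydenreich–van der Hofstad's Prop. 7.4, (7.5.3), "`Σ_x Π^{(N)}(x) ≤ Δ_p (2Δ̃_p Δ_p)^N`", PROVED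
for exactly these diagrams in `LaceExpansionXSpacePsiBounds.lean`
(`HvdH2017_prop74_piNDiagramPc_le`, with `Δ_{p_c} = percTriBar d`, `Δ̃_{p_c} = percTriTildeBar d`);
Hara's Step 2 ("peel off (open) triangles from left and right, leaving `|x|^β`-, `|x|^γ`-weighted
parts in the middle") is that computation with two of the loops replaced by the weighted blocks
`W̄, T̄, H̄`. (ii) Smallness: the geometric rate `ρ < 1` is "`λ` sufficiently small" (Hara,
Lemma 1.6; Prop. 1.2: `W̄^{(2,0)}_p, T̄^{(0,0)}_p < λ ≤ c₃/d`, `d ≥ 19`; the text is complete "say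
`d ≥ 30`", §1.2), and for `d ≥ 11` the computer-assisted input of Fitzner–van der Hofstad 2017,
§7 (proof of Thm. 1.4): "by our numerical computations in dimension `d = 11`,
`T̄^{(0,0)} = sup_x (τ_{p_c}^{⋆3}(x) - δ_{0,x}) ≤ 0.53562`, `T_{p_c} = 2dp_c sup_x (τ_{p_c}^{⋆3} ⋆ D)(x)
≤ 0.28036`. In particular, by a recent improvement of the bounds by Hara compared to [Hara08], it
suffices to prove that `T_{p_c}(1 + 2T̄^{(0,0)}) < 1`", and (proof of Thm. 1.5) the classical rate
"`Π̂^{(N)}_{p_c}(0) ≤ T'_{p_c}[2T_{p_c}T'_{p_c}]^{N-1}`, where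
`T'_p = max_x (τ_p ⋆ τ_p ⋆ τ_p)(x) ≤ 1 + T̄^{(0,0)}`".

In the notation of `LaceExpansionXSpacePsiBounds.lean`: `T_{p_c} = Δ̃_{p_c} = percTriTildeBar d`
(`τ ⋆ τ ⋆ τ̃ = 2dp_c τ^{⋆3} ⋆ D`) and `T'_{p_c} = Δ_{p_c} = percTriBar d`. This file adds:

* DEFINITIONS `percTri00 d x` — Hara's `T^{(0,0)}(x) = Σ_{y,z} G(y) G(z-y) G(x-z)
  {1 - I[y = z = x = 0]}` WITH its printed correction (§1.1), i.e. Fitzner–van der Hofstad's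
  `τ_{p_c}^{⋆3}(x) - δ_{0,x}` — and `percTriBar00 d = T̄^{(0,0)}_{p_c} = sup_x percTri00 d x`, in
  `[0, ∞]` (the uncorrected `haraTBar d 0 0 ≥ 1` of `LaceExpansionXSpaceNorms.lean` cannot express
  the smallness `T̄^{(0,0)} < λ`);
* PROVED `percTri_eq_ite_add_percTri00` (`Δ_{p_c}(x) = δ_{0,x} + T^{(0,0)}(x)`: the removed term is
  `τ(0)³ = 1`) and `percTriBar_le_one_add_percTriBar00` (`T' ≤ 1 + T̄^{(0,0)}`, loc. cit.);
* PROVED `weightedNLoopBound_zero_zero_of_triangle_le` — layers (i)+(ii) at `β = γ = 0`: if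
  `Δ̃_{p_c} ≤ a`, `Δ_{p_c} ≤ b` (`a, b > 0`) and `2ab < 1`, then the conclusion of
  `Hara2008_weightedNLoopBoundPc` holds for this `d` at `β = γ = 0` with `c = b`, `ρ = 2ab`;
* PROVED `weightedNLoopBound_zero_zero_eleven` — the instance `d = 11`, with the two printed
  numbers `T_{p_c} ≤ 0.28036`, `T̄^{(0,0)} ≤ 0.53562` as HYPOTHESES (a computer-assisted result,
  not restated as a named fact): rate `2 · 0.28036 · 1.53562 < 0.862`.

What this leaves of `Hara2008_weightedNLoopBoundPc`: Hara's Step 1 (distribution of `|x|^{β+γ}`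
over the `2N+1` segments of the upper and lower paths, factor `(2N+1)^{β+γ}` and `(2N+1)²`
choices) and Step 2 for the weighted blocks (cases (b-2), (b-3), (b-7) of Fig. 6, printed for
`N = 4`: "General cases will be extrapolated rather easily"), with constants good enough for
`d ≥ 11` (the "recent improvement of the bounds by Hara", unpublished: Fitzner–van der Hofstad,
§7 and Acknowledgements), and the numerical input for every `d ≥ 11`.

## References

* T. Hara, Ann. Probab. 36 (2008) 530–593 (arXiv:math-ph/0504021): §1.1 (definition of
  `T^{(β,γ)}(a)` with the correction `- I[x = y = a = 0] G(0)³`), Prop. 1.2 (`T̄^{(0,0)}_p < λ`),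
  Lemma 1.6, §3.1 ((3.3)–(3.4): "peel off"), §3.4 (Steps 1–3 and Summary: "the `N`-loop
  contribution is thus bounded by `c N^{2+β+γ}(2c'λ)^{N-2}`").
* R. Fitzner, R. van der Hofstad, Electron. J. Probab. 22 (2017) no. 43 (arXiv:1506.07977): §7,
  proof of Thm. 1.4 (the `d = 11` numerics `T̄^{(0,0)} ≤ 0.53562`, `T_{p_c} ≤ 0.28036`; "it
  suffices to prove that `T_{p_c}(1+2T̄^{(0,0)}) < 1`"), proof of Thm. 1.5
  (`Π̂^{(N)}_{p_c}(0) ≤ T'_{p_c}[2T_{p_c}T'_{p_c}]^{N-1}`, `T'_p = max_x τ_p^{⋆3}(x) ≤ 1 + T̄^{(0,0)}`),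
  Acknowledgements ("an improved version of this analysis in [Hara08] that Takashi shared with us").
* M. Heydenreich, R. van der Hofstad, *Progress in High-Dimensional Percolation and Random
  Graphs*, Springer 2017: (7.2.1)–(7.2.4), Prop. 7.4 ((7.5.3)) and the remark after it ("we need
  that `2Δ̃_pΔ_p < 1` in order for the geometric sum (over `N`) to converge").
-/

noncomputable section

namespace Literature.Barriers.CriticalPhenomena

open _root_.MeasureTheory _root_.Filter Literature.Probability.LatticeModels
  Literature.Probability.Percolation

open scoped ENNReal

variable {d : ℕ}

/-! ### Hara's corrected triangle `T^{(0,0)}(x)` and `T̄^{(0,0)}` at `p_c` -/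

/-- **`T^{(0,0)}(x) := Σ_{y,z} τ(y) τ(z - y) τ(x - z) {1 - I[y = z = x = 0]} ∈ [0, ∞]`** at
`p = p_c` — Hara's `T^{(β,γ)}(a)` at `β = γ = 0` WITH its printed correction `- I[a = 0] G(0)³`
(the single term `y = z = x = 0`, equal to `1`, removed); Fitzner–van der Hofstad's
`τ_{p_c}^{⋆3}(x) - δ_{0,x}`. Indexed by `(y, z) ∈ ℤ^d × ℤ^d` as `percTri`.
[cite: Hara2008, §1.1 (definition of T^{(β,γ)}(a))]
[cite: FitznerVanDerHofstad2017, §7 (proof of Thm. 1.4: T̄^{(0,0)} = sup_x (τ^{⋆3}(x) - δ_{0,x}))] -/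
def percTri00 (d : ℕ) (x : Site d) : ℝ≥0∞ :=
  ∑' yz : Site d × Site d, if x = 0 ∧ yz = (0, 0) then 0
    else tauPcE d yz.1 * tauPcE d (yz.2 - yz.1) * tauPcE d (x - yz.2)

/-- **`T̄^{(0,0)}_{p_c} := sup_x T^{(0,0)}(x) ∈ [0, ∞]`** (Hara: suprema "denoted by bars";
Fitzner–van der Hofstad's `T̄^{(0,0)} = sup_x (τ_{p_c}^{⋆3}(x) - δ_{0,x})`, "`≤ 0.53562`" in `d = 11`).
[cite: Hara2008, §1.1 (suprema denoted by bars) and Prop. 1.2 (T̄^{(0,0)}_p < λ)]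
[cite: FitznerVanDerHofstad2017, §7 (proof of Thm. 1.4)] -/
def percTriBar00 (d : ℕ) : ℝ≥0∞ := ⨆ x : Site d, percTri00 d x

/-- **`Δ_{p_c}(x) = δ_{0,x} + T^{(0,0)}(x)`**: the removed term is `τ(0)³ = 1`.
[cite: Hara2008, §1.1 (T^{(β,γ)}(a) = (G^{(β)} ⋆ G^{(γ)} ⋆ G)(a) - I[a = 0, β = γ = 0] G(0)³)] -/
theorem percTri_eq_ite_add_percTri00 (x : Site d) :
    percTri d x = (if x = 0 then 1 else 0) + percTri00 d x := by
  by_cases hx : x = 0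
  · subst hx
    rw [if_pos rfl, percTri, percTri00]
    have h : ∀ yz : Site d × Site d,
        tauPcE d yz.1 * tauPcE d (yz.2 - yz.1) * tauPcE d (0 - yz.2) =
          (if yz = (0, 0) then 1 else 0) +
            (if (0 : Site d) = 0 ∧ yz = (0, 0) then 0
              else tauPcE d yz.1 * tauPcE d (yz.2 - yz.1) * tauPcE d (0 - yz.2)) := by
      intro yz
      by_cases h : yz = (0, 0)
      · rw [if_pos h, if_pos ⟨rfl, h⟩, h]
        simp
      · rw [if_neg h, if_neg (fun h' => h h'.2), zero_add]
    rw [tsum_congr h, ENNReal.tsum_add, tsum_ite_eq (0, 0) (fun _ => (1 : ℝ≥0∞))]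
  · rw [if_neg hx, zero_add, percTri, percTri00]
    refine tsum_congr fun yz => ?_
    rw [if_neg (fun h' => hx h'.1)]

/-- `T^{(0,0)}(x) ≤ T̄^{(0,0)}`. [cite: Hara2008, §1.1 (suprema denoted by bars)] -/
theorem percTri00_le_percTriBar00 (x : Site d) : percTri00 d x ≤ percTriBar00 d :=
  le_iSup (fun x => percTri00 d x) x

/-- **`Δ_{p_c} ≤ 1 + T̄^{(0,0)}_{p_c}`** ("`T'_p = max_x (τ_p ⋆ τ_p ⋆ τ_p)(x) ≤ 1 + T̄^{(0,0)}`").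
[cite: FitznerVanDerHofstad2017, §7 (proof of Thm. 1.5, definition of T'_p)] -/
theorem percTriBar_le_one_add_percTriBar00 : percTriBar d ≤ 1 + percTriBar00 d := by
  refine iSup_le fun x => ?_
  rw [percTri_eq_ite_add_percTri00]
  refine add_le_add ?_ (percTri00_le_percTriBar00 x)
  split_ifs
  · exact le_rfl
  · exact zero_le

/-! ### The `β = γ = 0` case of `Hara2008_weightedNLoopBoundPc` from small triangles -/

/-- **The unweighted `N`-loop bound with a geometric rate, from the smallness of the triangles.**
If `Δ̃_{p_c} ≤ a`, `Δ_{p_c} ≤ b` (`a, b > 0`) and `2ab < 1`, then the conclusion of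
`Hara2008_weightedNLoopBoundPc` holds for this `d` at `β = γ = 0`, with `c = b` and `ρ = 2ab`:
`Σ_x |x|^0 piNDiagramPc d N x ≤ b (N+1)² (2ab)^N` for all `N ≥ 1` — Heydenreich–van der Hofstad's
(7.5.3) for the diagrams (`HvdH2017_prop74_piNDiagramPc_le`) and "we need that `2Δ̃_pΔ_p < 1` in
order for the geometric sum (over `N`) to converge"; in Hara's words "the `N`-loop contribution
is thus bounded by `c N^{2+β+γ}(2c'λ)^{N-2}` … the sum converges as long as `2c'λ < 1`".
[cite: Hara2008, §3.4 (Step 3 and Summary)]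
[cite: HeydenreichVanDerHofstad2017, Prop. 7.4 ((7.5.3)) and the remark after it] -/
theorem weightedNLoopBound_zero_zero_of_triangle_le {a b : ℝ} (ha : 0 < a) (hb : 0 < b)
    (hΔt : percTriTildeBar d ≤ ENNReal.ofReal a) (hΔ : percTriBar d ≤ ENNReal.ofReal b)
    (hab : 2 * a * b < 1) :
    ∃ c ρ : ℝ, 0 < ρ ∧ ρ < 1 ∧ ∀ N : ℕ, 1 ≤ N →
      ∑' x : Site d, ENNReal.ofReal (euclidNorm x ^ ((0 : ℝ) + 0)) * piNDiagramPc d N x ≤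
        ENNReal.ofReal (c * ((N : ℝ) + 1) ^ (2 + (0 : ℝ) + 0) * ρ ^ N) := by
  refine ⟨b, 2 * a * b, by positivity, hab, fun N hN => ?_⟩
  have h1 : ∀ x : Site d, ENNReal.ofReal (euclidNorm x ^ ((0 : ℝ) + 0)) * piNDiagramPc d N x =
      piNDiagramPc d N x := fun x => by
    rw [add_zero, Real.rpow_zero, ENNReal.ofReal_one, one_mul]
  rw [tsum_congr h1]
  calc ∑' x : Site d, piNDiagramPc d N x
      ≤ percTriBar d * (2 * percTriTildeBar d * percTriBar d) ^ N :=
        HvdH2017_prop74_piNDiagramPc_le N hN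
    _ ≤ ENNReal.ofReal b * (2 * ENNReal.ofReal a * ENNReal.ofReal b) ^ N := by gcongr
    _ = ENNReal.ofReal (b * (2 * a * b) ^ N) := by
        rw [ENNReal.ofReal_mul hb.le, ENNReal.ofReal_pow (by positivity),
          ENNReal.ofReal_mul (by positivity), ENNReal.ofReal_mul zero_le_two, ENNReal.ofReal_ofNat]
    _ ≤ ENNReal.ofReal (b * ((N : ℝ) + 1) ^ (2 + (0 : ℝ) + 0) * (2 * a * b) ^ N) := by
        refine ENNReal.ofReal_le_ofReal ?_
        have hN1 : (1 : ℝ) ≤ ((N : ℝ) + 1) ^ (2 + (0 : ℝ) + 0) :=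
          Real.one_le_rpow (by linarith [(Nat.cast_nonneg N : (0 : ℝ) ≤ N)]) (by norm_num)
        calc b * (2 * a * b) ^ N = b * 1 * (2 * a * b) ^ N := by ring
          _ ≤ b * ((N : ℝ) + 1) ^ (2 + (0 : ℝ) + 0) * (2 * a * b) ^ N := by gcongr

/-- **The instance `d = 11` from the printed numerics.** With Fitzner–van der Hofstad's
computer-assisted values "`T̄^{(0,0)} ≤ 0.53562`, `T_{p_c} ≤ 0.28036`" in `d = 11` taken as
hypotheses (`T_{p_c} = Δ̃_{p_c} = percTriTildeBar 11`, `T̄^{(0,0)} = percTriBar00 11`), the classical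
rate is `2T_{p_c}T'_{p_c} ≤ 2Δ̃_{p_c}(1 + T̄^{(0,0)}) ≤ 2 · 0.28036 · 1.53562 < 1`, so the conclusion
of `Hara2008_weightedNLoopBoundPc` holds for `d = 11` at `β = γ = 0`. (The numerics are not
restated as a named fact here.)
[cite: FitznerVanDerHofstad2017, §7 (proof of Thm. 1.4, the d = 11 numerics; proof of Thm. 1.5, T'_p ≤ 1 + T̄^{(0,0)})] -/
theorem weightedNLoopBound_zero_zero_eleven
    (hT : percTriTildeBar 11 ≤ ENNReal.ofReal 0.28036)
    (hTbar : percTriBar00 11 ≤ ENNReal.ofReal 0.53562) :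
    ∃ c ρ : ℝ, 0 < ρ ∧ ρ < 1 ∧ ∀ N : ℕ, 1 ≤ N →
      ∑' x : Site 11, ENNReal.ofReal (euclidNorm x ^ ((0 : ℝ) + 0)) * piNDiagramPc 11 N x ≤
        ENNReal.ofReal (c * ((N : ℝ) + 1) ^ (2 + (0 : ℝ) + 0) * ρ ^ N) := by
  have hΔ : percTriBar 11 ≤ ENNReal.ofReal 1.53562 :=
    calc percTriBar 11 ≤ 1 + percTriBar00 11 := percTriBar_le_one_add_percTriBar00
      _ ≤ 1 + ENNReal.ofReal 0.53562 := add_le_add le_rfl hTbar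
      _ = ENNReal.ofReal 1.53562 := by
          rw [← ENNReal.ofReal_one, ← ENNReal.ofReal_add zero_le_one (by norm_num)]
          norm_num
  exact weightedNLoopBound_zero_zero_of_triangle_le (by norm_num) (by norm_num) hT hΔ (by norm_num)

end Literature.Barriers.CriticalPhenomena
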